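import Summits.CriticalPhenomena.PercolationContinuityZ3.Theorems.SahiMasterFamilyCountingModel
import Summits.CriticalPhenomena.PercolationContinuityZ3.Theorems.SahiMasterFamilyCBarRefutationPrelim
import Summits.CriticalPhenomena.PercolationContinuityZ3.Theorems.SahiMasterFamilyUCBernsteinRootable

/-!
# The ROOT-FREE criterion (GD) "good surplus dominates crossing debt": `(k−1)·P_T ≥_B A_T`, equivalently
# `k·#all-bad ≤ (k−1)·#pointed` layer by layer; its one-line reduction to conjecture (B) at every two-sided pair; its
# block form `G_T − D_T`; and its count form

Unit `prim-masterthm-p4` (gen 28; crux anchor stmt-CriticalPhenomena-4575, helper work; memo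
`run/shared/lean/prim/prim-masterthm/prim-masterthm-p4/P4-GEN28-REPORT.md` §1–§2).  Companions: `…ComplementForm` (`badPoly` = `A`,
`capPoly z` = `W^{(z)}`, `Φ = Σ_z W^{(z)} − A` for every real set function), `…CountingModel` (`allBadCount`, `pointedCount`,
`Φ(mix) = Σ_s (pointed_s − allbad_s)·w^{k−s}(1−w)^s`), `…CBar` (`rooted`, `capW`, `badBlocks`, `goodBlocks`, `blockTerm`, `cbarSlack`,
`goodPart`, the root-summed identity `k·P_T = cbarSlack + goodPart`) and `…CBarRefutationPrelim` (`capW_rooted_eq_badOn`).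

SETTING.  `T = Fin (n+1)`, `k = n+1`; `𝒰, 𝒱` families of subsets of `T` (union-closed and containing `univ` in the conjecture); the EDGE
POLYNOMIAL `P_T(w) = Φ_k(w·1_𝒰 + (1−w)·1_𝒱)`; `A_T(w) = badPoly (mix 𝒰 𝒱 w)` the ALL-BAD polynomial (a cycle `c` is bad for the label `U`
with weight `w·[c ∉ 𝒰]` and for the label `V` with weight `(1−w)·[c ∉ 𝒱]`); conjecture (B) for the pair = `BPos k P_T`.

**THE CRITERION (GD) (`gdSlack`, typed conjecture `GD n`).**  `gdSlack 𝒰 𝒱 w := n·P_T(w) − A_T(w)` (`= (k−1)·P_T − A_T`).  Three readings: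
 * COUNT FORM (`gdSlack_eq_sum_counts`, `bpos_gdSlack_iff_counts`): the degree-`k` Bernstein coefficient of index `s` of `gdSlack` is
   `n·pointedCount_s − (n+1)·allBadCount_s`, so `BPos k gdSlack ⟺ ∀ s, k·#{all-bad configurations of layer s} ≤ (k−1)·#{pointed ones}` —
   versus (B) `⟺ #all-bad_s ≤ #pointed_s` (`CountingModel.bpos_mix_of_counts`): (GD) asks for the SAME count inequality with the constant
   `k/(k−1) > 1`.  In the coin model (uniform `σ ∈ S_k`, i.i.d. labels): `P(all cycles bad) ≤ (1 − 1/k)·P(all cycles of σ−y bad off y)`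
   for a uniform point `y`, i.e. `P(all-bad | σ is not the full cycle) ≤` the pointed all-bad probability.
 * BLOCK FORM (`gdSlack_eq_goodPart_add_debtPart`, for pairs containing `univ` in both families): `gdSlack = goodPart + debtPart`, the
   ROOT-SUMMED block sum `Σ_z Σ_{B ∋ z, B ≠ T} (|B|−1)!·γ_B·P_{T∖B} = Σ_{∅≠B⊊T} |B|!·γ_B·P_{T∖B}` over ALL proper blocks (`γ_B = 1−β_B`),
   i.e. `G_T − D_T` with `G_T = goodPart` (good complements, `P_{T∖B} ≥_B 0` under (B♮)) and `−D_T = debtPart` (bad complements,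
   `P_{T∖B} ≤_B 0` by the sign law): **(GD) ⟺ the good surplus dominates the crossing debt, summed over all roots** — the cap terms
   `W^{(z)}` of the block expansion are not used at all.  Compare (C̄) (`RootSummed.CBar`, REFUTED from 11 points, `…CBarRefutation`):
   `cbarSlack = Σ_z W^{(z)} + debtPart ≥_B 0` uses the caps and concedes the good surplus; `cbarSlack + goodPart = gdSlack + Σ_z W^{(z)} = k·P_T`.
 * REDUCTION (`bpos_mix_of_gdSlack`, NO hypothesis on the families): `k·P_T = gdSlack + (P_T + A_T)` and `P_T + A_T = Σ_z W^{(z)} ≥_B 0`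
   (`ComplementForm.bpos_phiSet_mix_add_badPoly`), so **`BPos k gdSlack ⇒ BPos k P_T`**: (GD) at a pair implies conjecture (B) for that
   pair OUTRIGHT — no induction over restrictions, no root choice, no one-sided companion (`bpos_mix_of_GD`, `phiSet_mix_nonneg_of_GD`).

EVIDENCE (P4-GEN28-REPORT §1; exact integer arithmetic outside the kernel): `k = 4` EXHAUSTIVE — all 374 715 ordered two-sided pairs of
union-closed families containing `univ` (165 orbit representatives × 2 271 families): 0 failures (and the one-sided analogue `G ≥ D`: all
34 485 pairs, 0 failures); random union-closed pairs `k = 5, 6`; the pinned-block family `PB(b)` for all `b ≤ 11` (`k ≤ 13`), on which (C̄), the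
A-criterion and the smaller-side root-sum die: `gdSlack = (b−1)!·(1−w)·u^{b−1}·(b·u² − w(1−w)) ≥_B 0`; ADVERSARIAL hill-climbing in the dense
regime (families given by unions of non-member stars, `k = 6…12`, ≈ 3.7·10⁵ evaluations) and in the generic regime (union-closures of random
generators, `k = 5…8`, ≈ 4.9·10⁵ evaluations): 0 failures, the minimum `0` being ATTAINED in interior layers (equality cases: `𝒰 = 𝒱 = {T}`
in every layer; the "glued pair" families `{S : S ∩ {a,b} ∈ {∅, {a,b}}}`; nested pairs with `G = 0`); `k = 5` exhaustive (kit job, report §1).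
Refinements that FAIL already on 4 points: per block size, per root, cumulative in the block size, weights `|B|²·(|B|−1)!`.  The variant with
weights `(|B|−1)!` instead of `|B|!` ((R2): "cycle-marked all-bad configurations obey the (B) count inequality") also has 0 failures in all of
the above but has no reduction to (B).
HULL FORM (`GDHull k`, appended): for every finite mixture `β` of union-closed indicators, `A(β) ≤ k·Φ_{k+1}(β)` pointwise; `ucHullNonneg_of_GDHull`:
`(GD-hull)_{k+1} ⇒ (UC-hull)_{k+1}` (`0 ≤ A(β)`), so the polytope form of (GD) implies Sahi positivity on the whole union-closed polytope.
THEOREM (`bpos_gdSlack_of_disjointUnion`, appended): (GD) holds for every union-closed pair containing `univ` with the DISJOINT-UNION condition (nested pairs, up-sets,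
union-closed unions) — every block term is `≥_B 0` because every restriction is rootable (`…UCBernsteinRootable`); `bpos_gdSlack_of_restrictions` is the general lemma.
STATUS UPDATE (appended the same day): **(GD) IS REFUTED from 6 points** by the bi-glued pair of P4-GEN20 (`gdSlack` layer-3 coefficient `−72`;
pointwise from 8 points); the `(|B|−1)!`-weighted sibling (R2) (`r2Slack`, typed `R2 n`, theorem on the disjoint-union class) survives every test — see the
last section.  The reductions `bpos_mix_of_gdSlack`, `ucHullNonneg_of_GDHull` stay valid as implications from (now known to be false in general) hypotheses;
`bpos_gdSlack_of_disjointUnion` stays a theorem.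
HONEST FRAMING: definitions, three identities, typed conjectures (GD, GDHull: REFUTED; R2: open), proved one-line reductions and (GD)/(R2) on the rootable-by-(HD) class; (GD) itself, conjecture (B),
`UCHullNonneg k` (k ≥ 8), Sahi's `C_k` and the master theorem remain OPEN.  (GD) is tight (slack exactly `0` in some layer) on a rich family of
pairs, so any proof must be an exact accounting.  Axioms standard. [this work]
-/

noncomputable section

open scoped Classical

namespace Summit.CriticalPhenomena.PercolationContinuityZ3.Theorems

namespace GoodDebt

open Finset Function Equiv
open Literature.Combinatorics.Sahi2008
open Literature.Combinatorics.Sahi2008.CycleForm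
open PrincipalCapBeta (phiSet realF realW)
open BernsteinPos UCBernsteinNested RootSummed ComplementForm

variable {n : ℕ}

/-! ### The (GD) slack and the reduction to (B) -/

/-- **The (GD) slack** `n·P_T(w) − A_T(w) = (k−1)·Φ_k(w·1_𝒰 + (1−w)·1_𝒱) − A(w·1_𝒰 + (1−w)·1_𝒱)` (`k = n+1`). [this work] -/
def gdSlack (𝒰 𝒱 : Finset (Finset (Fin (n + 1)))) (w : ℝ) : ℝ :=
  (n : ℝ) * phiSet (n + 1) (mix 𝒰 𝒱 w) - badPoly (mix 𝒰 𝒱 w)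

/-- `k·P_T = gdSlack + Σ_z W^{(z)}` (complement form `P_T = Σ_z W^{(z)} − A_T`). [this work] -/
theorem succ_mul_phiSet_eq_gdSlack_add (𝒰 𝒱 : Finset (Finset (Fin (n + 1)))) (w : ℝ) :
    ((n : ℝ) + 1) * phiSet (n + 1) (mix 𝒰 𝒱 w) = gdSlack 𝒰 𝒱 w + ∑ z : Fin (n + 1), capPoly z (mix 𝒰 𝒱 w) := by
  unfold gdSlack
  rw [← phiSet_add_badPoly]
  ring

/-- The sum of the cap polynomials `Σ_z W^{(z)}` along a two-family mixture is Bernstein-positive of degree `k`. [this work] -/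
theorem bpos_sum_capPoly_mix (𝒰 𝒱 : Finset (Finset (Fin (n + 1)))) :
    BPos (n + 1) (fun w => ∑ z : Fin (n + 1), capPoly z (mix 𝒰 𝒱 w)) :=
  BPos.sum univ (fun z w => capPoly z (mix 𝒰 𝒱 w)) fun z _ => (bpos_capPoly_mix 𝒰 𝒱 z).mono (Nat.le_succ n)

/-- **THE REDUCTION (every pair of families, no hypothesis).**  If the (GD) slack `(k−1)·P_T − A_T` is Bernstein-positive of degree `k`,
then so is the edge polynomial `P_T`: `k·P_T = gdSlack + Σ_z W^{(z)}` with `Σ_z W^{(z)} ≥_B 0`. [this work] -/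
theorem bpos_mix_of_gdSlack (𝒰 𝒱 : Finset (Finset (Fin (n + 1)))) (h : BPos (n + 1) (gdSlack 𝒰 𝒱)) :
    BPos (n + 1) (fun w => phiSet (n + 1) (mix 𝒰 𝒱 w)) := by
  have hk : BPos (n + 1) (fun w => ((n : ℝ) + 1) * phiSet (n + 1) (mix 𝒰 𝒱 w)) :=
    (h.add (bpos_sum_capPoly_mix 𝒰 𝒱)).congr fun w => (succ_mul_phiSet_eq_gdSlack_add 𝒰 𝒱 w).symm
  have hpos : (0 : ℝ) ≤ 1 / ((n : ℝ) + 1) := by positivity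
  refine (hk.smul hpos).congr fun w => ?_
  have hne : ((n : ℝ) + 1) ≠ 0 := by positivity
  field_simp

/-! ### The count form -/

/-- **Count form of the (GD) slack**: its degree-`k` Bernstein coefficient of index `s` is `n·pointedCount_s − (n+1)·allBadCount_s`. [this work] -/
theorem gdSlack_eq_sum_counts (𝒰 𝒱 : Finset (Finset (Fin (n + 1)))) (w : ℝ) :
    gdSlack 𝒰 𝒱 w = ∑ s ∈ range (n + 2),
      (((n : ℝ) * pointedCount 𝒰 𝒱 s - ((n : ℝ) + 1) * allBadCount 𝒰 𝒱 s) * (w ^ (n + 1 - s) * (1 - w) ^ s)) := by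
  unfold gdSlack
  rw [phiSet_mix_eq_sum_counts, badPoly_mix_eq_sum_configs, sum_configs_by_layer w (LabelTransport.AllBad 𝒰 𝒱), mul_sum,
    ← sum_sub_distrib]
  unfold allBadCount
  exact sum_congr rfl fun s _ => by ring

/-- **(GD) as a count inequality**: `BPos k gdSlack ⟺ ∀ s, k·#all-bad_s ≤ (k−1)·#pointed_s` (`k = n+1`). [this work] -/
theorem bpos_gdSlack_iff_counts (𝒰 𝒱 : Finset (Finset (Fin (n + 1)))) :
    BPos (n + 1) (gdSlack 𝒰 𝒱) ↔ ∀ s ≤ n + 1, (n + 1) * allBadCount 𝒰 𝒱 s ≤ n * pointedCount 𝒰 𝒱 s := by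
  constructor
  · intro h s hs
    have key := UCBernsteinNested.bernstein_coeff_nonneg_of_bpos h
      (fun s => (n : ℝ) * pointedCount 𝒰 𝒱 s - ((n : ℝ) + 1) * allBadCount 𝒰 𝒱 s) (fun w => gdSlack_eq_sum_counts 𝒰 𝒱 w) s hs
    have key' : ((n : ℝ) + 1) * allBadCount 𝒰 𝒱 s ≤ (n : ℝ) * pointedCount 𝒰 𝒱 s := sub_nonneg.1 key
    exact_mod_cast key'
  · intro h
    refine (BPos.sum (range (n + 2)) (fun s w => (((n : ℝ) * pointedCount 𝒰 𝒱 s - ((n : ℝ) + 1) * allBadCount 𝒰 𝒱 s) *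
      (w ^ (n + 1 - s) * (1 - w) ^ s))) fun s hs => ?_).congr fun w => (gdSlack_eq_sum_counts 𝒰 𝒱 w).symm
    have hs' : s ≤ n + 1 := by have := mem_range.1 hs; omega
    refine bpos_monomial ?_ (n + 1 - s) s (by omega)
    have h1 : ((n : ℝ) + 1) * allBadCount 𝒰 𝒱 s ≤ (n : ℝ) * pointedCount 𝒰 𝒱 s := by exact_mod_cast h s hs'
    exact sub_nonneg.2 h1

/-! ### The block form `G_T − D_T` (pairs containing `univ` in both families) -/

/-- The cap term of the pair rooted at `z` is the cap polynomial `W^{(z)}` of the pair. [this work] -/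
theorem capW_rooted_eq_capPoly (z : Fin (n + 1)) (𝒰 𝒱 : Finset (Finset (Fin (n + 1)))) (w : ℝ) :
    capW (rooted z 𝒰) (rooted z 𝒱) w = capPoly z (mix 𝒰 𝒱 w) := by
  rw [CBarRefutation.capW_rooted_eq_badOn, ← badSum_realW_ne]
  unfold badOn
  let e : {x // x ≠ z} ≃ {x // x ∈ (univ : Finset (Fin (n + 1))).erase z} :=
    Equiv.subtypeEquivRight fun x => by simp only [mem_erase, mem_univ, and_true]
  rw [← badSum_comp_equiv (realW (mix 𝒰 𝒱 w)) e]
  rfl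

/-- The DEBT part `−D_T = Σ_z Σ_{B ∋ z, B ≠ T, T∖B bad} (|B|−1)!·γ_B·P_{T∖B}` (the bad-complement block terms of `cbarSlack`, without the
caps; `≤_B 0` for union-closed pairs by the sign law of `…UCBernsteinUpper`). [this work] -/
def debtPart (𝒰 𝒱 : Finset (Finset (Fin (n + 1)))) (w : ℝ) : ℝ :=
  ∑ z : Fin (n + 1), ∑ B ∈ badBlocks (rooted z 𝒰) (rooted z 𝒱), blockTerm (rooted z 𝒰) (rooted z 𝒱) B w

/-- `cbarSlack = Σ_z W^{(z)} + debtPart`. [this work] -/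
theorem cbarSlack_eq_sum_capPoly_add_debtPart (𝒰 𝒱 : Finset (Finset (Fin (n + 1)))) (w : ℝ) :
    cbarSlack 𝒰 𝒱 w = (∑ z : Fin (n + 1), capPoly z (mix 𝒰 𝒱 w)) + debtPart 𝒰 𝒱 w := by
  unfold cbarSlack debtPart
  rw [← sum_add_distrib]
  exact sum_congr rfl fun z _ => by rw [capW_rooted_eq_capPoly]

/-- **BLOCK FORM**: for a pair with `univ ∈ 𝒰 ∩ 𝒱`, `gdSlack = goodPart + debtPart = Σ_{∅≠B⊊T} |B|!·γ_B·P_{T∖B}` — good surplus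
`G_T` minus crossing debt `D_T`. [this work] -/
theorem gdSlack_eq_goodPart_add_debtPart (𝒰 𝒱 : Finset (Finset (Fin (n + 1)))) (hU : univ ∈ 𝒰) (hV : univ ∈ 𝒱) (w : ℝ) :
    gdSlack 𝒰 𝒱 w = goodPart 𝒰 𝒱 w + debtPart 𝒰 𝒱 w := by
  have h1 := sum_roots_identity 𝒰 𝒱 hU hV w
  have h2 := succ_mul_phiSet_eq_gdSlack_add 𝒰 𝒱 w
  rw [cbarSlack_eq_sum_capPoly_add_debtPart] at h1
  linarith

/-- `cbarSlack + goodPart = gdSlack + Σ_z W^{(z)}` (both equal `k·P_T`): (C̄) spends the caps and concedes the good surplus, (GD) spends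
the good surplus and concedes the caps. [this work] -/
theorem cbarSlack_add_goodPart_eq (𝒰 𝒱 : Finset (Finset (Fin (n + 1)))) (hU : univ ∈ 𝒰) (hV : univ ∈ 𝒱) (w : ℝ) :
    cbarSlack 𝒰 𝒱 w + goodPart 𝒰 𝒱 w = gdSlack 𝒰 𝒱 w + ∑ z : Fin (n + 1), capPoly z (mix 𝒰 𝒱 w) := by
  rw [← sum_roots_identity 𝒰 𝒱 hU hV w, succ_mul_phiSet_eq_gdSlack_add]

/-! ### The typed conjecture and its consequences -/

/-- **CONJECTURE (GD) at order `n+1`** ("good dominates debt"; P4-GEN28-REPORT §1): for every pair of union-closed families of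
subsets of `Fin (n+1)` both containing `univ`, `(n : ℝ)·P_T − A_T` is Bernstein-positive of degree `n+1` — equivalently
`(n+1)·allBadCount_s ≤ n·pointedCount_s` in every layer, equivalently `goodPart + debtPart ≥_B 0`.  Exhaustive on 4 points, 0 failures in
≈ 9·10⁵ random/structured/adversarial pairs on 5–13 points (module docstring); tight on a large family of pairs.  A conjecture-valued
definition, never a fact. [this work] [status: open] -/
@[conjecture] def GD (n : ℕ) : Prop :=
  ∀ 𝒰 𝒱 : Finset (Finset (Fin (n + 1))),
    (∀ A ∈ 𝒰, ∀ B ∈ 𝒰, A ∪ B ∈ 𝒰) → (∀ A ∈ 𝒱, ∀ B ∈ 𝒱, A ∪ B ∈ 𝒱) → univ ∈ 𝒰 → univ ∈ 𝒱 → BPos (n + 1) (gdSlack 𝒰 𝒱)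

/-- The trivial order: on one point `P_T = 1` and `A_T = 0` (the only cycle is `univ`, good for both labels), so `gdSlack = 0·1 − 0 = 0`.
[this work] -/
theorem gd_zero : GD 0 := by
  intro 𝒰 𝒱 _ _ hU hV
  have key : ∀ w, gdSlack 𝒰 𝒱 w = 0 := by
    intro w
    unfold gdSlack badPoly
    have horb : ∀ σ : Perm (Fin (0 + 1)), ∀ B ∈ orbits σ, B = univ := by
      intro σ B hB
      obtain ⟨i, _, rfl⟩ := mem_image.1 hB
      ext j
      simp only [mem_univ, iff_true]
      rw [Fin.eq_zero j, Fin.eq_zero i]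
      exact self_mem_orbit σ 0
    have hprod : ∀ σ : Perm (Fin (0 + 1)), ∏ B ∈ orbits σ, (1 - mix 𝒰 𝒱 w B) = 0 := by
      intro σ
      have hne : (univ : Finset (Fin (0 + 1))) ∈ orbits σ := by
        have h0 : orbit σ 0 ∈ orbits σ := mem_image_of_mem _ (mem_univ _)
        rwa [horb σ _ h0] at h0
      refine prod_eq_zero hne ?_
      unfold mix
      rw [if_pos hU, if_pos hV]
      ring
    simp only [hprod, sum_const_zero, Nat.cast_zero, zero_mul, sub_zero]
  exact (bpos_const le_rfl).congr fun w => (key w).symm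

/-- **(GD) ⇒ (B) for every two-sided pair of the same order** — no induction, no root choice. [this work] -/
theorem bpos_mix_of_GD (hGD : GD n) (𝒰 𝒱 : Finset (Finset (Fin (n + 1))))
    (hUC : ∀ A ∈ 𝒰, ∀ B ∈ 𝒰, A ∪ B ∈ 𝒰) (hVC : ∀ A ∈ 𝒱, ∀ B ∈ 𝒱, A ∪ B ∈ 𝒱) (hU : univ ∈ 𝒰) (hV : univ ∈ 𝒱) :
    BPos (n + 1) (fun w => phiSet (n + 1) (mix 𝒰 𝒱 w)) :=
  bpos_mix_of_gdSlack 𝒰 𝒱 (hGD 𝒰 𝒱 hUC hVC hU hV)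

/-- (GD) ⇒ the layerwise count inequality `k·#all-bad_s ≤ (k−1)·#pointed_s` (in particular `#all-bad_s ≤ #pointed_s`, conjecture (B)
in count form). [this work] -/
theorem counts_le_of_GD (hGD : GD n) (𝒰 𝒱 : Finset (Finset (Fin (n + 1))))
    (hUC : ∀ A ∈ 𝒰, ∀ B ∈ 𝒰, A ∪ B ∈ 𝒰) (hVC : ∀ A ∈ 𝒱, ∀ B ∈ 𝒱, A ∪ B ∈ 𝒱) (hU : univ ∈ 𝒰) (hV : univ ∈ 𝒱) :
    ∀ s ≤ n + 1, (n + 1) * allBadCount 𝒰 𝒱 s ≤ n * pointedCount 𝒰 𝒱 s :=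
  (bpos_gdSlack_iff_counts 𝒰 𝒱).1 (hGD 𝒰 𝒱 hUC hVC hU hV)

/-- **(GD) ⇒ (UC-hull) on the edge `[1_𝒰, 1_𝒱]`** for every two-sided union-closed pair of the same order (pointwise form). [this work] -/
theorem phiSet_mix_nonneg_of_GD (hGD : GD n) (𝒰 𝒱 : Finset (Finset (Fin (n + 1))))
    (hUC : ∀ A ∈ 𝒰, ∀ B ∈ 𝒰, A ∪ B ∈ 𝒰) (hVC : ∀ A ∈ 𝒱, ∀ B ∈ 𝒱, A ∪ B ∈ 𝒱) (hU : univ ∈ 𝒰) (hV : univ ∈ 𝒱)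
    {w : ℝ} (hw0 : 0 ≤ w) (hw1 : w ≤ 1) : 0 ≤ phiSet (n + 1) (mix 𝒰 𝒱 w) :=
  (bpos_mix_of_GD hGD 𝒰 𝒱 hUC hVC hU hV).nonneg hw0 hw1

/-! ### The hull form: (GD) on the whole union-closed polytope, and `(GD-hull)_{k+1} ⇒ (UC-hull)_{k+1}` -/

/-- The all-bad polynomial `A(β) = Σ_σ ∏_c (1 − β_c)` is nonnegative whenever `β ≤ 1` pointwise. [this work] -/
theorem badPoly_nonneg_of_le_one {k : ℕ} (β : Finset (Fin (k + 1)) → ℝ) (h1 : ∀ S, β S ≤ 1) : 0 ≤ badPoly β := by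
  unfold badPoly
  exact sum_nonneg fun σ _ => prod_nonneg fun B _ => sub_nonneg.2 (h1 B)

/-- A convex mixture of indicator values is at most `1`. [this work] -/
theorem mixture_le_one {k : ℕ} {α : Type} [Fintype α] (w : α → ℝ) (𝒰 : α → Finset (Finset (Fin k)))
    (hw0 : ∀ x, 0 ≤ w x) (hw1 : ∑ x, w x = 1) (S : Finset (Fin k)) :
    ∑ x, w x * (if S ∈ 𝒰 x then (1 : ℝ) else 0) ≤ 1 := by
  calc ∑ x, w x * (if S ∈ 𝒰 x then (1 : ℝ) else 0) ≤ ∑ x, w x :=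
        sum_le_sum fun x _ => by
          by_cases h : S ∈ 𝒰 x
          · rw [if_pos h, mul_one]
          · rw [if_neg h, mul_zero]; exact hw0 x
    _ = 1 := hw1

/-- **CONJECTURE (GD-hull) at order `k+1`** (the polytope form of (GD); P4-GEN28-REPORT §1): for every finite mixture
`β = Σ_x w_x·1_{𝒰_x}` of indicator functions of union-closed families of subsets of `Fin (k+1)` containing `univ`,
`A(β) ≤ k·Φ_{k+1}(β)` — the all-bad partition function is at most `(k+1) − 1` times Sahi's functional; equivalently (complement form)
`A(β) ≤ (k/(k+1))·Σ_z W^{(z)}(β)`.  On an edge `[1_𝒰, 1_𝒱]` it is the pointwise shadow of `GD k`; numerically clean deep inside the hull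
(random mixtures of up to 12 families on 6–11 points, minimum relative margin ≈ 0.02–0.05) and coefficientwise for 3- and 4-family mixtures on
4–5 points.  A conjecture-valued definition, never a fact. [this work] [status: open] -/
@[conjecture] def GDHull (k : ℕ) : Prop :=
  ∀ (α : Type) [Fintype α] (w : α → ℝ) (𝒰 : α → Finset (Finset (Fin (k + 1)))),
    (∀ x, 0 ≤ w x) → ∑ x, w x = 1 → (∀ x, ∀ A ∈ 𝒰 x, ∀ A' ∈ 𝒰 x, A ∪ A' ∈ 𝒰 x) → (∀ x, univ ∈ 𝒰 x) →
      badPoly (fun S => ∑ x, w x * (if S ∈ 𝒰 x then (1 : ℝ) else 0)) ≤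
        (k : ℝ) * phiSet (k + 1) (fun S => ∑ x, w x * (if S ∈ 𝒰 x then (1 : ℝ) else 0))

/-- **`(GD-hull)_{k+1} ⇒ (UC-hull)_{k+1}`** for `k ≥ 1`: `0 ≤ A(β) ≤ k·Φ_{k+1}(β)`. [this work] -/
theorem ucHullNonneg_of_GDHull {k : ℕ} (hk : 1 ≤ k) (h : GDHull k) : GHConjecture.UCHullNonneg (k + 1) := by
  intro α _ w 𝒰 hw0 hw1 hUC htop
  have hA := badPoly_nonneg_of_le_one (fun S => ∑ x, w x * (if S ∈ 𝒰 x then (1 : ℝ) else 0))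
    (fun S => mixture_le_one w 𝒰 hw0 hw1 S)
  have hle := h α w 𝒰 hw0 hw1 hUC htop
  have hkpos : (0 : ℝ) < k := by exact_mod_cast hk
  nlinarith

/-- (GD) for a pair gives the hull inequality on its edge pointwise: `A_T(w) ≤ n·P_T(w)` for `w ∈ [0,1]`. [this work] -/
theorem badPoly_le_of_GD (hGD : GD n) (𝒰 𝒱 : Finset (Finset (Fin (n + 1))))
    (hUC : ∀ A ∈ 𝒰, ∀ B ∈ 𝒰, A ∪ B ∈ 𝒰) (hVC : ∀ A ∈ 𝒱, ∀ B ∈ 𝒱, A ∪ B ∈ 𝒱) (hU : univ ∈ 𝒰) (hV : univ ∈ 𝒱)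
    {w : ℝ} (hw0 : 0 ≤ w) (hw1 : w ≤ 1) : badPoly (mix 𝒰 𝒱 w) ≤ (n : ℝ) * phiSet (n + 1) (mix 𝒰 𝒱 w) := by
  have h := (hGD 𝒰 𝒱 hUC hVC hU hV).nonneg hw0 hw1
  unfold gdSlack at h
  linarith

/-! ### (GD) is a THEOREM wherever every restriction is Bernstein-positive — in particular for every pair with the disjoint-union condition -/

/-- A single block term of the rooted block expansion is Bernstein-positive as soon as the edge polynomial of the complementary pulled-back pair is:
`(|B|−1)!·(1 − β_B)·(−κ_B)` with `1 − β_B` `BPos 1` and `−κ_B` the edge polynomial of the restriction to `univ ∖ B`. [this work] -/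
theorem bpos_blockTerm_of_restrictions (𝒰 𝒱 : Finset (Finset (Fin (n + 1))))
    (hall : ∀ (m : ℕ) (e : Fin (m + 1) ↪ Fin (n + 1)), m < n →
      BPos (m + 1) (fun w => phiSet (m + 1) (mix (comap e 𝒰) (comap e 𝒱) w)))
    (z : Fin (n + 1)) {B : Finset (Fin (n + 1))} (hlB : Fin.last n ∈ B) (hBu : B ≠ univ) :
    BPos (n + 1) (fun w => blockTerm (rooted z 𝒰) (rooted z 𝒱) B w) := by
  obtain ⟨m, e, he, hsurj, hc⟩ := exists_emb_coRest' hBu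
  have hm : m < n := PhiVertex.lt_of_emb_ne_last e fun j hj => he j (by rw [hj]; exact hlB)
  have key : BPos (m + 1) (fun w => phiSet (m + 1) (mix (comap e (rooted z 𝒰)) (comap e (rooted z 𝒱)) w)) := by
    unfold rooted
    rw [comap_comap', comap_comap']
    exact hall m _ hm
  have hsub : BPos n (fun w => -coRest (realW (mix (rooted z 𝒰) (rooted z 𝒱) w)) realF B) := by
    refine (key.mono (by omega)).congr fun w => ?_
    rw [hc, mix_map, neg_neg]
  unfold blockTerm
  exact (((bpos_one_sub_mix' (rooted z 𝒰) (rooted z 𝒱) B).mul hsub).smul (Nat.cast_nonneg _)).mono (by omega)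

/-- **(GD) holds for every pair with `univ` in both families all of whose proper pulled-back pairs have a Bernstein-positive edge polynomial** (then EVERY block
term of `goodPart + debtPart` is `≥_B 0`; no sign analysis of the complements is needed). [this work] -/
theorem bpos_gdSlack_of_restrictions (𝒰 𝒱 : Finset (Finset (Fin (n + 1)))) (hU : univ ∈ 𝒰) (hV : univ ∈ 𝒱)
    (hall : ∀ (m : ℕ) (e : Fin (m + 1) ↪ Fin (n + 1)), m < n →
      BPos (m + 1) (fun w => phiSet (m + 1) (mix (comap e 𝒰) (comap e 𝒱) w))) :
    BPos (n + 1) (gdSlack 𝒰 𝒱) := by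
  have hgood : BPos (n + 1) (goodPart 𝒰 𝒱) := by
    unfold goodPart
    refine BPos.sum univ (fun z w => ∑ B ∈ goodBlocks (rooted z 𝒰) (rooted z 𝒱), blockTerm (rooted z 𝒰) (rooted z 𝒱) B w) fun z _ => ?_
    refine BPos.sum _ (fun B w => blockTerm (rooted z 𝒰) (rooted z 𝒱) B w) fun B hB => ?_
    obtain ⟨hlB, hBu, _⟩ := (mem_filter.1 hB).2
    exact bpos_blockTerm_of_restrictions 𝒰 𝒱 hall z hlB hBu
  have hdebt : BPos (n + 1) (debtPart 𝒰 𝒱) := by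
    unfold debtPart
    refine BPos.sum univ (fun z w => ∑ B ∈ badBlocks (rooted z 𝒰) (rooted z 𝒱), blockTerm (rooted z 𝒰) (rooted z 𝒱) B w) fun z _ => ?_
    refine BPos.sum _ (fun B w => blockTerm (rooted z 𝒰) (rooted z 𝒱) B w) fun B hB => ?_
    obtain ⟨hlB, hBu, _⟩ := (mem_filter.1 hB).2
    exact bpos_blockTerm_of_restrictions 𝒰 𝒱 hall z hlB hBu
  exact (hgood.add hdebt).congr fun w => (gdSlack_eq_goodPart_add_debtPart 𝒰 𝒱 hU hV w).symm

/-- The disjoint-union condition `A ∈ 𝒰, B ∈ 𝒱, A ∩ B = ∅ ⇒ A ∪ B ∈ 𝒰 ∪ 𝒱` is inherited by pulled-back pairs. [this work] -/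
theorem disjointUnion_comap {m : ℕ} (e : Fin (m + 1) ↪ Fin (n + 1)) {𝒰 𝒱 : Finset (Finset (Fin (n + 1)))}
    (hD : ∀ A ∈ 𝒰, ∀ B ∈ 𝒱, Disjoint A B → A ∪ B ∈ 𝒰 ∪ 𝒱) :
    ∀ A ∈ comap e 𝒰, ∀ B ∈ comap e 𝒱, Disjoint A B → A ∪ B ∈ comap e 𝒰 ∪ comap e 𝒱 := by
  intro A hA B hB hAB
  rw [mem_comap] at hA hB
  rw [← comap_union, mem_comap, Finset.map_union]
  exact hD _ hA _ hB ((Finset.disjoint_map e).2 hAB)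

/-- **THEOREM: (GD) for every pair of union-closed families containing `univ` with the disjoint-union condition** (⊇ nested pairs, pairs of up-sets,
union-closed unions; 75.4 % of ordered pairs on 4 points): all proper restrictions are rootable (`UCBernsteinRootable.rootable_of_disjointUnion`), hence
Bernstein-positive, hence every block term of `gdSlack = goodPart + debtPart` is `≥_B 0`. [this work] -/
theorem bpos_gdSlack_of_disjointUnion (𝒰 𝒱 : Finset (Finset (Fin (n + 1))))
    (hUC : ∀ A ∈ 𝒰, ∀ B ∈ 𝒰, A ∪ B ∈ 𝒰) (hVC : ∀ A ∈ 𝒱, ∀ B ∈ 𝒱, A ∪ B ∈ 𝒱) (hU : univ ∈ 𝒰) (hV : univ ∈ 𝒱)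
    (hD : ∀ A ∈ 𝒰, ∀ B ∈ 𝒱, Disjoint A B → A ∪ B ∈ 𝒰 ∪ 𝒱) :
    BPos (n + 1) (gdSlack 𝒰 𝒱) :=
  bpos_gdSlack_of_restrictions 𝒰 𝒱 hU hV fun m e _ =>
    UCBernsteinRootable.bpos_phiSet_mix_of_rootable
      (UCBernsteinRootable.rootable_of_disjointUnion m (comap e 𝒰) (comap e 𝒱) (comap_unionClosed e 𝒰 hUC) (comap_unionClosed e 𝒱 hVC)
        (disjointUnion_comap e hD))
      (comap_unionClosed e 𝒰 hUC) (comap_unionClosed e 𝒱 hVC)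

/-- In particular (GD) holds for every NESTED pair `𝒰 ⊆ 𝒱` of union-closed families containing `univ`. [this work] -/
theorem bpos_gdSlack_of_subset {𝒰 𝒱 : Finset (Finset (Fin (n + 1)))} (hUV : 𝒰 ⊆ 𝒱)
    (hUC : ∀ A ∈ 𝒰, ∀ B ∈ 𝒰, A ∪ B ∈ 𝒰) (hVC : ∀ A ∈ 𝒱, ∀ B ∈ 𝒱, A ∪ B ∈ 𝒱) (hU : univ ∈ 𝒰) (hV : univ ∈ 𝒱) :
    BPos (n + 1) (gdSlack 𝒰 𝒱) :=
  bpos_gdSlack_of_disjointUnion 𝒰 𝒱 hUC hVC hU hV fun _A hA _B hB _ => mem_union.2 (Or.inr (hVC _ (hUV hA) _ hB))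

/-! ### STATUS (same generation, later in the session): (GD) is REFUTED from 6 points; the cycle-marked sibling (R2) survives

The BI-GLUED pair of P4-GEN20 (`T = H₁ ⊔ H₂`, `|H₁| = |H₂| = 3`, `𝒰 = {S : S ∩ H₁ ∈ {∅, H₁}} ∪ {S ⊇ H₂}`, `𝒱` the mirror) has
`gdSlack` Bernstein vector `(108, 294, 153, −72, 153, 294, 108)` (layer 3: `6·allBadCount = 6·3547 = 21282 > 5·pointedCount = 5·4242 = 21210`), so
`GD 5` is FALSE; from 8 points the same family violates (GD) pointwise at `w = ½` (`7·P_T(½) < A_T(½)`), so `GDHull 7` is false too; the bi-glued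
pairs `(h | k−h)`, `h ≥ 3`, fail for every `k ≤ 14` tested (two independent exact engines).  The reductions above remain theorems; the criterion they
reduce to is dead.  What survives every test of the generation (k ≤ 5 exhaustive, all structured families to 12–14 points including the bi-glued ones,
≈ 2·10⁶ adversarial evaluations, 3-family / diluted mixtures): the `(|B|−1)!`-weighted sibling (R2) below — "cycle-MARKED all-bad configurations obey the
(B) count inequality", equivalently `∇Φ_T(β)·(β − 𝟙) ≥ 0`, the derivative of Sahi's functional along the ray from the top vertex `𝟙 = 1_{2^T}`; on the
whole union-closed hull it would give `(UC-hull)` by integration along `[𝟙, β]` (not formalised).  P4-GEN28-REPORT §1b/§6. -/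

/-- **The (R2) slack**: the root-summed block sum with every block term divided by `|B|`, i.e. `Σ_{∅≠B⊊T} (|B|−1)!·γ_B·P_{T∖B}` — the
CYCLE-weighted (rather than point-weighted) block sum; `= d/ds Φ_T(𝟙 + s(β − 𝟙))|_{s=1}`. [this work] -/
def r2Slack (𝒰 𝒱 : Finset (Finset (Fin (n + 1)))) (w : ℝ) : ℝ :=
  ∑ z : Fin (n + 1), ((∑ B ∈ goodBlocks (rooted z 𝒰) (rooted z 𝒱), (B.card : ℝ)⁻¹ * blockTerm (rooted z 𝒰) (rooted z 𝒱) B w) +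
    ∑ B ∈ badBlocks (rooted z 𝒰) (rooted z 𝒱), (B.card : ℝ)⁻¹ * blockTerm (rooted z 𝒰) (rooted z 𝒱) B w)

/-- **CONJECTURE (R2) at order `n+1`** (P4-GEN28-REPORT §6): for every pair of union-closed families of subsets of `Fin (n+1)` both containing `univ`,
`r2Slack` is Bernstein-positive of degree `n+1`.  Exhaustive on ≤ 5 points (19 891 190 480 two-sided pairs), 0 failures on every structured family of the
programme to 12–14 points (including the bi-glued pairs that refute (GD)) and under ≈ 2·10⁶ adversarial evaluations; tight on the same equality cases as (GD).
Unlike (GD) it does NOT by itself give (B) for the pair; its hull form gives `(UC-hull)` by integration.  A conjecture-valued definition, never a fact.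
[this work] [status: open] -/
@[conjecture] def R2 (n : ℕ) : Prop :=
  ∀ 𝒰 𝒱 : Finset (Finset (Fin (n + 1))),
    (∀ A ∈ 𝒰, ∀ B ∈ 𝒰, A ∪ B ∈ 𝒰) → (∀ A ∈ 𝒱, ∀ B ∈ 𝒱, A ∪ B ∈ 𝒱) → univ ∈ 𝒰 → univ ∈ 𝒱 → BPos (n + 1) (r2Slack 𝒰 𝒱)

/-- (R2) holds for every pair containing `univ` in both families all of whose proper pulled-back pairs are Bernstein-positive (every block term `≥_B 0`).
[this work] -/
theorem bpos_r2Slack_of_restrictions (𝒰 𝒱 : Finset (Finset (Fin (n + 1))))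
    (hall : ∀ (m : ℕ) (e : Fin (m + 1) ↪ Fin (n + 1)), m < n →
      BPos (m + 1) (fun w => phiSet (m + 1) (mix (comap e 𝒰) (comap e 𝒱) w))) :
    BPos (n + 1) (r2Slack 𝒰 𝒱) := by
  unfold r2Slack
  refine BPos.sum univ _ fun z _ => BPos.add ?_ ?_
  · refine BPos.sum _ (fun B w => (B.card : ℝ)⁻¹ * blockTerm (rooted z 𝒰) (rooted z 𝒱) B w) fun B hB => ?_
    obtain ⟨hlB, hBu, _⟩ := (mem_filter.1 hB).2
    exact (bpos_blockTerm_of_restrictions 𝒰 𝒱 hall z hlB hBu).smul (inv_nonneg.2 (Nat.cast_nonneg _))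
  · refine BPos.sum _ (fun B w => (B.card : ℝ)⁻¹ * blockTerm (rooted z 𝒰) (rooted z 𝒱) B w) fun B hB => ?_
    obtain ⟨hlB, hBu, _⟩ := (mem_filter.1 hB).2
    exact (bpos_blockTerm_of_restrictions 𝒰 𝒱 hall z hlB hBu).smul (inv_nonneg.2 (Nat.cast_nonneg _))

/-- **THEOREM: (R2) for every pair of union-closed families with the disjoint-union condition** (tops not even needed: every block term is `≥_B 0`). [this work] -/
theorem bpos_r2Slack_of_disjointUnion (𝒰 𝒱 : Finset (Finset (Fin (n + 1))))
    (hUC : ∀ A ∈ 𝒰, ∀ B ∈ 𝒰, A ∪ B ∈ 𝒰) (hVC : ∀ A ∈ 𝒱, ∀ B ∈ 𝒱, A ∪ B ∈ 𝒱)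
    (hD : ∀ A ∈ 𝒰, ∀ B ∈ 𝒱, Disjoint A B → A ∪ B ∈ 𝒰 ∪ 𝒱) :
    BPos (n + 1) (r2Slack 𝒰 𝒱) :=
  bpos_r2Slack_of_restrictions 𝒰 𝒱 fun m e _ =>
    UCBernsteinRootable.bpos_phiSet_mix_of_rootable
      (UCBernsteinRootable.rootable_of_disjointUnion m (comap e 𝒰) (comap e 𝒱) (comap_unionClosed e 𝒰 hUC) (comap_unionClosed e 𝒱 hVC)
        (disjointUnion_comap e hD))
      (comap_unionClosed e 𝒰 hUC) (comap_unionClosed e 𝒱 hVC)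

end GoodDebt

end Summit.CriticalPhenomena.PercolationContinuityZ3.Theorems
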